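import Summits.Schanuel.Schanuel.Theorems.RootDecomp1KSectorTheorem03

/-!
# RootDecomp1KSectorTheorem — lens 1, generation 67, NODE 27 «THE SECTOR THEOREM BY ONE NEWTON STEP AT (∞,∞) — THE EDGE ENGINE» — FORK (B): the FIRST-ORDER SECTOR THEOREM at FLOOR F (`thinFibreAt_of_sectorCond : c k ≠ 0 → DomZero k c → SectorCond m₀ k c → ThinFibreAt m₀ (xPolyP k c)`, every m₀ / k / monomial support, the only escape the typed residue `Residue m₀ k c`; one PROVED Diophantine input `Ridout.padicRoth_int`; CLAIM L3031, PRICE L3032, ADDENDUM L3037, RULE K-R58, NODE L3047, VERDICT L3050) — continuation (RootDecomp1KSectorTheorem04): §6  The `2`-adic exclusion: RIDOUT at the single place `2` on the roots of the edge polynomial · §7  THE EDGE ENGINE: a good slope carries only finitely many levels — 10 declarations `arch_finite` … `factorial_pred_le_div`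

(lens-1 g67 NODE 27 «THE SECTOR THEOREM BY ONE NEWTON STEP AT (∞,∞) — THE EDGE ENGINE» L3047: HOME kernel K = HOME/decomp-schanuel-lens-1/g67/lean/SectorTheorem.lean sha256 bbe43d14…, 2869 l, ONE namespace `Summit.Schanuel.Schanuel.Theorems.RootDecomp1KSectorTheorem`, imports the tree port …RootDecomp1KDigitPincer03 ONLY (node 26's record port; its closure holds every cell file used); no private / instance / set_option / notation / sorry / new axiom / binder / `decide` on levels; lens farm rc 0 · 0 errors · 0 sorries · warnings dupNamespace only, `--axioms` standard on the 18 deciding declarations, Probe rc 0 (g67/out/); memo g67/NODE-g67.md; CLAIM L3031 (ASK-FIRST under K-R57 (iii)); crit g12 PRICE L3032 (fork (A) ×0-AS-RECORD as posted / fork (B) a kernel meeting FLOOR F = «FIRST-ORDER SECTOR THEOREM» = THEOREM ×1 consuming K-R57 (iii); CHECKLIST K-g67 F1–F6 + S1–S8; RULE K-R58 PRE-ANNOUNCED) and PRICE ADDENDUM L3037 ((F6′) `W4P` by tree name; the ρ3 specimen `x² + x·Y² + Y⁵ + 3` of writer NOTE 17 L3036 = the F5 exhibit); census instruments LIVENESS-v36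 (key edge) / v37 (key ls2); crit g12 VERDICT L3050 (2026-09-02T03:35Z): THEOREM ×1 GRANTED under K-R57 (iii) for FORK (B) = the FIRST-ORDER SECTOR THEOREM AT FLOOR F (F1 F2 F3 (T) F4(α) F4(β) F5 F6 F6′ R-27-i and CHECKLIST S1–S8 met on the critic's own farm runs), the single ×1 of the sector line CONSUMED (K-R58 (i): no further ×1 on this line), TALLY lens-1 ×22 + THEOREM ×24, RULE K-R58 FIXED (PRICE L3032 (i)–(v) verbatim with the ADDENDUM L3037 gloss; W-27-2 = a ×0 wish for typed stratum predicates), PORT GO → census-1 (this port; PORT IDENTITY 27 owed by the seated critic). Port by census-1 gen 25 as `RootDecomp1KSectorTheorem01–10` (files ≤ 400 lines; `--supports stmt-Schanuel-33364`, the item stays OPEN; no census credit carried; RULE K-R58 (iv): UNCONDITIONAL PART ∪= these names): 01 = K l.1–307 of the prepped source (opens §1 / §2 / §3) — 20 decls `dMax`, `box`, `supp`, …, `two_zpow_inj`; 02 = K l.308–570 of the prepped source (opens §4) — 5 decls `far_pair`, `natDegree_le_dMax`, `norm_pow_sub_one_le`, …, `mem_supp`; 03 = K l.571–896 of the prepped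 source (opens §4b / §5) — 12 decls `layered_bound`, `edge_bound_one`, `edge_bound_crude`, …, `tendsto_partialSum_two`; 04 = K l.897–1221 of the prepped source (opens §6 / §7) — 10 decls `arch_finite`, `ridout_two`, `lt_rpow_neg_of_pow_mul_pow_lt`, …, `factorial_pred_le_div`; 05 = K l.1222–1500 of the prepped source (opens §8) — 4 decls `pair_levels_finite`, `dvd_lc_pow_val`, `den_le_of_dvd`, `den_rescaled_le`; 06 = K l.1501–1822 of the prepped source (opens §9) — 13 decls `size_regime`, `c_zero_ne_zero`, `far_levels_finite`, …, `sum_range_ite_shift`; 07 = K l.1823–2080 of the prepped source (inside §9) — 14 decls `layerPoly_lin2`, `layer0_lin2`, `layer1_lin2`, …, `natDegree_scaleShift`; 08 = K l.2081–2401 of the prepped source (opens §10) — 18 decls `thinFibreAt_xLinear`, `thinFibreAt_xPolyP_one`, `edgeGood_of_gap`, …, `thinFibreAt_M_sector`; 09 = K l.2402–2627 of the prepped source (opens §11) — 17 decls `sectorCond_beta0_example`, `thinFibreAt_beta0_example`, `thinFibreAt_generic_xLinear_example`, …, `rho2_two`; 10 = K l.2628–2905 of the prepped source (opens §12) — 13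 decls `residue_rho2`, `rho3`, `rho3_zero`, …, `W4P_eq`. 39 one-line docstrings synthesised for undocumented helper declarations (statements quoted, census port convention since gen 22); everything else = K VERBATIM (statements, names, proofs, K's module docstring kept in part 01 below this provenance block).)
-/

noncomputable section

namespace Summit.Schanuel.Schanuel.Theorems.RootDecomp1KSectorTheorem

open Polynomial LiouvilleNumber
open scoped Nat
open Summit.Schanuel.Schanuel.Theorems.RootDecomp1KTwoBaseCell (psNumer partialSum_eq_psNumer_div coprime_psNumer)
open Summit.Schanuel.Schanuel.Theorems.RootDecomp1KRelLiouvilleCell (partialSum_two_strictMono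
  abs_liouvilleNumber_two_sub_partialSum)
open Summit.Schanuel.Schanuel.Theorems.RootDecomp1KDegreeLadder
open Summit.Schanuel.Schanuel.Theorems.RootDecomp1KXLinear (xLinP bev_xLinP norm_ratCast_two norm_ratCast_of_le
  norm_psNumer_sub_one)
open Summit.Schanuel.Schanuel.Theorems.RootDecomp1KDigitPincer (xc XP X6P)
open Summit.Schanuel.Schanuel.Theorems.RootDecomp1KOddEmpty (W4P w4C vG natDegree_vG)
open Summit.Schanuel.Schanuel.Theorems.RootDecomp1KHyperellipticSiegel (mQ mC mC_zero mC_one mC_two natDegree_mQ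
  coeff_mQ_five leadingCoeff_mQ)
open Summit.Schanuel.Schanuel.Theorems.RootDecomp1KXLinearII (norm_aeval_le norm_psNumer)
open Summit.Schanuel.Schanuel.Theorems.RootDecomp1KXTop
open Summit.Schanuel.Schanuel.Theorems.RootDecomp1KXAll
open Summit.Schanuel.Schanuel.Theorems.RootDecomp1KLevelFinite
open Summit.Schanuel.Schanuel.Theorems.RootDecomp1KLocalExponent
open Summit.Schanuel.Schanuel.Theorems.RootDecomp1KIntegrality

/-- **ARCHIMEDEAN EXCLUSION.**  For `P ≠ 0` and a FIXED rational `W₀ ≠ 0`, the rescaled point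
`(s_N, W₀ / 2^{s·(N!/q)})` lies on `P = 0` for only finitely many `N ≥ q` (`s ≥ 1`): write `P = Y^a · Q` with
`Q(x, 0) = Q₀(x) ≠ 0`; then `P(s_N, y_N) = y_N^a · Q(s_N, y_N)` with `y_N → 0`, `s_N → ℓ₂` and `Q(ℓ₂, 0) = Q₀(ℓ₂) ≠ 0`
(`ℓ₂` transcendental). -/
theorem arch_finite (P : ℤ[X][X]) (hP : P ≠ 0) {W₀ : ℚ} (hW₀ : W₀ ≠ 0) {s q : ℕ} (hs : 0 < s) (hq : 0 < q) :
    {N : ℕ | q ≤ N ∧ bev P (partialSum 2 N) ((W₀ : ℝ) / 2 ^ (s * (N ! / q))) = 0}.Finite := by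
  classical
  obtain ⟨Q, hPQ, hndvd⟩ := P.exists_eq_pow_rootMultiplicity_mul_and_not_dvd hP 0
  rw [map_zero, sub_zero] at hPQ hndvd
  have hQ0 : Q.coeff 0 ≠ 0 := fun h => hndvd (X_dvd_iff.mpr h)
  set a := rootMultiplicity 0 P with ha
  -- `Q(ℓ₂, 0) ≠ 0`
  have hQval : bev Q (liouvilleNumber 2) 0 ≠ 0 := by
    rw [bev_eq_sum Q (Nat.lt_succ_self _), Finset.sum_range_succ', pow_zero, mul_one]
    rw [Finset.sum_eq_zero fun j _ => by rw [zero_pow (Nat.succ_ne_zero j), mul_zero], zero_add]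
    intro h0
    exact transcendental_ell2 ⟨Q.coeff 0, hQ0, h0⟩
  -- the sequence `(s_N, y_N) → (ℓ₂, 0)`
  set y : ℕ → ℝ := fun N => (W₀ : ℝ) / 2 ^ (s * (N ! / q)) with hy
  have hy_tend : Filter.Tendsto y Filter.atTop (nhds 0) := by
    rw [Metric.tendsto_atTop]
    intro ε hε
    have hA : (0 : ℝ) < |(W₀ : ℝ)| + 1 := by positivity
    obtain ⟨m, hm⟩ := exists_pow_lt_of_lt_one (div_pos hε hA) (by norm_num : (1 / 2 : ℝ) < 1)
    refine ⟨max q (m + 1), fun N hN => ?_⟩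
    have hqN : q ≤ N := le_trans (le_max_left _ _) hN
    have hmN : m + 1 ≤ N := le_trans (le_max_right _ _) hN
    -- `N!/q ≥ (N-1)! ≥ N - 1 ≥ m`
    have hn : m ≤ s * (N ! / q) := by
      have h1 : (N - 1)! ≤ N ! / q := by
        rw [Nat.le_div_iff_mul_le hq]
        have : N ! = N * (N - 1)! := by
          obtain ⟨M, rfl⟩ : ∃ M, N = M + 1 := ⟨N - 1, by omega⟩
          rw [Nat.factorial_succ, Nat.add_sub_cancel]
        rw [this, mul_comm]
        exact Nat.mul_le_mul_right _ hqN
      have h2 : N - 1 ≤ (N - 1)! := Nat.self_le_factorial _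
      have h3 : N ! / q ≤ s * (N ! / q) := Nat.le_mul_of_pos_left _ hs
      omega
    rw [Real.dist_eq, sub_zero, hy]
    simp only
    rw [abs_div, abs_of_pos (by positivity : (0 : ℝ) < 2 ^ (s * (N ! / q))), div_eq_mul_inv,
      ← half_pow_eq_inv]
    have h3 : (1 / 2 : ℝ) ^ (s * (N ! / q)) ≤ (1 / 2 : ℝ) ^ m :=
      pow_le_pow_of_le_one (by norm_num) (by norm_num) hn
    have h4 : (|(W₀ : ℝ)| + 1) * (ε / (|(W₀ : ℝ)| + 1)) = ε := mul_div_cancel₀ ε hA.ne'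
    calc |(W₀ : ℝ)| * (1 / 2 : ℝ) ^ (s * (N ! / q)) ≤ (|(W₀ : ℝ)| + 1) * (1 / 2 : ℝ) ^ m :=
          mul_le_mul (by linarith) h3 (by positivity) hA.le
      _ < (|(W₀ : ℝ)| + 1) * (ε / (|(W₀ : ℝ)| + 1)) := mul_lt_mul_of_pos_left hm hA
      _ = ε := h4
  have hpair : Filter.Tendsto (fun N => (partialSum 2 N, y N)) Filter.atTop
      (nhds (liouvilleNumber 2, (0 : ℝ))) := tendsto_partialSum_two.prodMk_nhds hy_tend
  have hev : ∀ᶠ p : ℝ × ℝ in nhds (liouvilleNumber 2, (0 : ℝ)), bev Q p.1 p.2 ≠ 0 :=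
    (continuous_bev₂ Q).continuousAt.eventually_ne hQval
  obtain ⟨N₀, hN₀⟩ := Filter.eventually_atTop.mp (hpair.eventually hev)
  refine (Set.finite_lt_nat N₀).subset fun N hN => ?_
  obtain ⟨hqN, hzero⟩ := hN
  rw [Set.mem_setOf_eq]
  by_contra hge
  push Not at hge
  have h1 := hN₀ N hge
  have hyN : y N ≠ 0 := by
    simp only [hy]; exact div_ne_zero (by exact_mod_cast hW₀) (by positivity)
  apply h1
  have h2 : bev P (partialSum 2 N) (y N) = (y N) ^ a * bev Q (partialSum 2 N) (y N) := by
    rw [hPQ, bev_mul, bev_pow, bev_X]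
  have h3 : bev P (partialSum 2 N) (y N) = 0 := hzero
  rw [h2] at h3
  rcases mul_eq_zero.mp h3 with h | h
  · exact absurd (pow_eq_zero_iff'.mp h).1 hyN
  · exact h

/-! ## §6  The `2`-adic exclusion: RIDOUT at the single place `2` on the roots of the edge polynomial -/

/-- **Ridout at the place `2`** (the tree's PROVED `Literature…Ridout.padicRoth_int`, specialised to `S = {2}`; no
binder, no irrationality hypothesis): for `α ∈ ℂ₂` algebraic over `ℚ` and `ε > 0`, only finitely many integers `m`
have `min(1, ‖m − α‖₂) < |m|^{−(1+ε)}`. -/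
theorem ridout_two (α : PadicAlgCl 2) (hα : IsAlgebraic ℚ α) {ε : ℝ} (hε : 0 < ε) :
    {m : ℤ | min (1 : ℝ) ‖(m : PadicAlgCl 2) - α‖ < |(m : ℝ)| ^ (-(1 + ε))}.Finite := by
  classical
  set A : ∀ p : Nat.Primes, @PadicAlgCl (p : ℕ) ⟨p.2⟩ :=
    Function.update (fun p => (0 : @PadicAlgCl (p : ℕ) ⟨p.2⟩)) pTwo α with hAdef
  have hA : A pTwo = α := by
    rw [hAdef]
    exact Function.update_self (β := fun p : Nat.Primes => @PadicAlgCl (p : ℕ) ⟨p.2⟩) pTwo α _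
  have halg : ∀ p ∈ ({pTwo} : Finset Nat.Primes), IsAlgebraic ℚ (A p) := by
    intro p hp
    rw [Finset.mem_singleton] at hp
    subst hp
    rw [hA]; exact hα
  have h := Literature.NumberTheory.DiophantineApproximation.Ridout.padicRoth_int {pTwo} A halg hε
  refine h.subset fun m hm => ?_
  show (∏ p ∈ ({pTwo} : Finset Nat.Primes), min (1 : ℝ) ‖((m : ℤ) : @PadicAlgCl (p : ℕ) ⟨p.2⟩) - A p‖) < _
  rw [Finset.prod_singleton, hA]
  exact hm

/-- real-power bookkeeping for Ridout: `a^t · b^{t+1} < 1 ⟹ a < b^{−(1 + 1/t)}`. -/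
theorem lt_rpow_neg_of_pow_mul_pow_lt {a b : ℝ} (hb : 0 < b) {t : ℕ} (ht : 0 < t)
    (h : a ^ t * b ^ (t + 1) < 1) : a < b ^ (-(1 + 1 / (t : ℝ))) := by
  have ht' : (0 : ℝ) < t := by exact_mod_cast ht
  set X : ℝ := b ^ (-(1 + 1 / (t : ℝ))) with hX
  have hX0 : 0 < X := Real.rpow_pos_of_pos hb _
  have hXt : X ^ t = (b ^ (t + 1))⁻¹ := by
    rw [hX, ← Real.rpow_natCast, ← Real.rpow_mul hb.le]
    have : (-(1 + 1 / (t : ℝ))) * (t : ℝ) = -((t + 1 : ℕ) : ℝ) := by push_cast; field_simp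
    rw [this, Real.rpow_neg hb.le, Real.rpow_natCast]
  have h1 : a ^ t < X ^ t := by
    rw [hXt, inv_eq_one_div, lt_div_iff₀ (pow_pos hb _)]
    exact h
  exact lt_of_pow_lt_pow_left₀ t hX0.le h1

/-- `N! = q·n` with `N ≥ 4q` gives `n ≥ 4·(N−1)!`. -/
theorem four_mul_factorial_le {N q n : ℕ} (hq : 0 < q) (hN : 4 * q ≤ N) (hn : N ! = q * n) : 4 * (N - 1)! ≤ n := by
  have hfac : N ! = N * (N - 1)! := by
    obtain ⟨M, rfl⟩ : ∃ M, N = M + 1 := ⟨N - 1, by omega⟩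
    rw [Nat.factorial_succ, Nat.add_sub_cancel]
  have h1 : q * (4 * (N - 1)!) ≤ q * n := by
    rw [← hn, hfac, ← mul_assoc]
    exact Nat.mul_le_mul_right _ (by omega)
  exact Nat.le_of_mul_le_mul_left h1 hq

/-- **the exponent arithmetic of the Ridout step**: with `t = 2μs`, `μs + 1 ≤ G`, `μs + 1 ≤ q`, `N! = q·n`, `N ≥ 4q`:
`s·n·(t+1) + 2s·(N−1)! ≤ 2s·G·n` and `≤ 2s·(N! − (N−1)!)`. -/
theorem exp_arith {N q s μ G n : ℕ} (hq : 0 < q) (hN : 4 * q ≤ N) (hn : N ! = q * n) (hG : μ * s + 1 ≤ G)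
    (hQ : μ * s + 1 ≤ q) :
    s * n * (2 * μ * s + 1) + 2 * s * (N - 1)! ≤ 2 * s * (G * n) ∧
      s * n * (2 * μ * s + 1) + 2 * s * (N - 1)! ≤ 2 * s * (Nat.factorial N - Nat.factorial (N - 1)) := by
  have h4 := four_mul_factorial_le hq hN hn
  have hfac : (N - 1)! ≤ N ! := Nat.factorial_le (Nat.sub_le N 1)
  constructor
  · have : n * (2 * μ * s + 1) + 2 * (N - 1)! ≤ 2 * (G * n) := by nlinarith
    nlinarith
  · have h1 : n * (2 * μ * s + 1) + 2 * (N - 1)! + 2 * (N - 1)! ≤ 2 * N ! := by nlinarith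
    have h2 : n * (2 * μ * s + 1) + 2 * (N - 1)! ≤ 2 * (Nat.factorial N - Nat.factorial (N - 1)) := by omega
    nlinarith

/-- the real form: `(h^{Gn} + h^{K})^{2s} · 2^{s·n·(t+1)} ≤ 4^s · h^{(N−1)!}` (`h = 1/2`). -/
theorem decay_bound {N q s μ G n : ℕ} (hs : 0 < s) (hq : 0 < q) (hN : 4 * q ≤ N) (hn : N ! = q * n)
    (hG : μ * s + 1 ≤ G) (hQ : μ * s + 1 ≤ q) :
    ((1 / 2 : ℝ) ^ (G * n) + (1 / 2 : ℝ) ^ (Nat.factorial N - Nat.factorial (N - 1))) ^ (2 * s) *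
        (2 : ℝ) ^ (s * n * (2 * μ * s + 1)) ≤ (4 : ℝ) ^ s * (1 / 2 : ℝ) ^ (N - 1)! := by
  obtain ⟨h1, h2⟩ := exp_arith hq hN hn hG hQ
  set E₀ : ℕ := s * n * (2 * μ * s + 1) + 2 * s * (N - 1)! with hE₀
  set K : ℕ := Nat.factorial N - Nat.factorial (N - 1) with hK
  set m₁ : ℝ := max ((1 / 2 : ℝ) ^ (G * n)) ((1 / 2 : ℝ) ^ K) with hm₁
  have hm₁0 : 0 ≤ m₁ := le_max_of_le_left (by positivity)
  have hsum : (1 / 2 : ℝ) ^ (G * n) + (1 / 2 : ℝ) ^ K ≤ 2 * m₁ := by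
    have := le_max_left ((1 / 2 : ℝ) ^ (G * n)) ((1 / 2 : ℝ) ^ K)
    have := le_max_right ((1 / 2 : ℝ) ^ (G * n)) ((1 / 2 : ℝ) ^ K)
    linarith
  have hm₁E : m₁ ^ (2 * s) ≤ (1 / 2 : ℝ) ^ E₀ := by
    rcases le_total ((1 / 2 : ℝ) ^ (G * n)) ((1 / 2 : ℝ) ^ K) with h | h
    · rw [hm₁, max_eq_right h, ← pow_mul]
      exact pow_le_pow_of_le_one (by norm_num) (by norm_num) (by rw [mul_comm]; exact h2)
    · rw [hm₁, max_eq_left h, ← pow_mul]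
      exact pow_le_pow_of_le_one (by norm_num) (by norm_num) (by rw [mul_comm]; exact h1)
  have hE : (1 / 2 : ℝ) ^ E₀ * (2 : ℝ) ^ (s * n * (2 * μ * s + 1)) = (1 / 2 : ℝ) ^ (2 * s * (N - 1)!) := by
    rw [hE₀, pow_add, mul_assoc, mul_comm ((1 / 2 : ℝ) ^ (2 * s * (N - 1)!)), ← mul_assoc, ← mul_pow]
    norm_num
  have hlast : (1 / 2 : ℝ) ^ (2 * s * (N - 1)!) ≤ (1 / 2 : ℝ) ^ (N - 1)! :=
    pow_le_pow_of_le_one (by norm_num) (by norm_num) (Nat.le_mul_of_pos_left _ (by omega))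
  calc ((1 / 2 : ℝ) ^ (G * n) + (1 / 2 : ℝ) ^ K) ^ (2 * s) * (2 : ℝ) ^ (s * n * (2 * μ * s + 1))
      ≤ (2 * m₁) ^ (2 * s) * (2 : ℝ) ^ (s * n * (2 * μ * s + 1)) :=
        mul_le_mul_of_nonneg_right (pow_le_pow_left₀ (by positivity) hsum _) (by positivity)
    _ = (4 : ℝ) ^ s * (m₁ ^ (2 * s) * (2 : ℝ) ^ (s * n * (2 * μ * s + 1))) := by
        rw [mul_pow, pow_mul]; norm_num; ring
    _ ≤ (4 : ℝ) ^ s * ((1 / 2 : ℝ) ^ E₀ * (2 : ℝ) ^ (s * n * (2 * μ * s + 1))) :=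
        mul_le_mul_of_nonneg_left (mul_le_mul_of_nonneg_right hm₁E (by positivity)) (by positivity)
    _ = (4 : ℝ) ^ s * (1 / 2 : ℝ) ^ (2 * s * (N - 1)!) := by rw [hE]
    _ ≤ (4 : ℝ) ^ s * (1 / 2 : ℝ) ^ (N - 1)! := mul_le_mul_of_nonneg_left hlast (by positivity)

/-- `h^{Gn} + h^{K} ≤ 2·h^{(N−1)!}` for `N ≥ max(q, 2)`, `G ≥ 1`, `N! = q·n`. -/
theorem crude_bound {N q G n : ℕ} (hq : 0 < q) (hN : q ≤ N) (hN2 : 2 ≤ N) (hn : N ! = q * n) (hG : 0 < G) :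
    (1 / 2 : ℝ) ^ (G * n) + (1 / 2 : ℝ) ^ (Nat.factorial N - Nat.factorial (N - 1)) ≤
      2 * (1 / 2 : ℝ) ^ (N - 1)! := by
  have hfac : N ! = N * (N - 1)! := by
    obtain ⟨M, rfl⟩ : ∃ M, N = M + 1 := ⟨N - 1, by omega⟩
    rw [Nat.factorial_succ, Nat.add_sub_cancel]
  have hn1 : (N - 1)! ≤ n := by
    have h1 : q * (N - 1)! ≤ q * n := by
      rw [← hn, hfac]; exact Nat.mul_le_mul_right _ hN
    exact Nat.le_of_mul_le_mul_left h1 hq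
  have hGn : (N - 1)! ≤ G * n := le_trans hn1 (Nat.le_mul_of_pos_left _ hG)
  have hK : (N - 1)! ≤ Nat.factorial N - Nat.factorial (N - 1) := by
    have : 2 * (N - 1)! ≤ N ! := by rw [hfac]; exact Nat.mul_le_mul_right _ hN2
    omega
  have h1 : (1 / 2 : ℝ) ^ (G * n) ≤ (1 / 2 : ℝ) ^ (N - 1)! := pow_le_pow_of_le_one (by norm_num) (by norm_num) hGn
  have h2 : (1 / 2 : ℝ) ^ (Nat.factorial N - Nat.factorial (N - 1)) ≤ (1 / 2 : ℝ) ^ (N - 1)! :=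
    pow_le_pow_of_le_one (by norm_num) (by norm_num) hK
  linarith

/-- `h^{(N−1)!}` beats any constant: `A · h^{(N−1)!} < δ` for `N ≥ N₀`. -/
theorem eventually_small (A δ : ℝ) (hδ : 0 < δ) : ∃ N₀ : ℕ, ∀ N, N₀ ≤ N → A * (1 / 2 : ℝ) ^ (N - 1)! < δ := by
  by_cases hA : A ≤ 0
  · exact ⟨0, fun N _ => lt_of_le_of_lt (mul_nonpos_of_nonpos_of_nonneg hA (by positivity)) hδ⟩
  push Not at hA
  obtain ⟨m, hm⟩ := exists_pow_lt_of_lt_one (div_pos hδ hA) (by norm_num : (1 / 2 : ℝ) < 1)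
  refine ⟨m + 1, fun N hN => ?_⟩
  have h1 : m ≤ (N - 1)! := le_trans (by omega) (Nat.self_le_factorial _)
  have h2 : (1 / 2 : ℝ) ^ (N - 1)! ≤ (1 / 2 : ℝ) ^ m := pow_le_pow_of_le_one (by norm_num) (by norm_num) h1
  calc A * (1 / 2 : ℝ) ^ (N - 1)! ≤ A * (1 / 2 : ℝ) ^ m := mul_le_mul_of_nonneg_left h2 hA.le
    _ < A * (δ / A) := mul_lt_mul_of_pos_left hm hA
    _ = δ := mul_div_cancel₀ δ hA.ne'

/-! ## §7  THE EDGE ENGINE: a good slope carries only finitely many levels -/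

/-- **THE RIDOUT BLOCK.**  Fix an algebraic `β ∈ ℂ₂`, an exponent `μ ≥ 1` and a depth `G` with `μ·s + 1 ≤ G` and
`μ·s + 1 ≤ q`.  Then only finitely many levels `N ≥ 4q` carry a level point `r` whose rescaling `W = r·2^{s·N!/q} ≠ 0`
has `den W ≤ Dn`, `|W| ≤ C·2^{s·N!/q}` and `‖W − β‖^μ ≤ A·((1/2)^{G·N!/q} + (1/2)^{N!−(N−1)!})`: RIDOUT at the place
`2` for the integers `Dn!·W` against `Dn!·β` leaves finitely many `W`, each excluded archimedeanly (§5). -/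
theorem ridout_levels_finite (k : ℕ) (c : ℕ → ℤ[X]) (hB : c k ≠ 0) {s q : ℕ} (hs : 0 < s) (hq : 0 < q)
    {β : PadicAlgCl 2} (hβalg : IsAlgebraic ℚ β) {μ G : ℕ} (hμ : 0 < μ) (hG : μ * s + 1 ≤ G)
    (hQ : μ * s + 1 ≤ q) {A : ℝ} (hA : 0 ≤ A) (C : ℝ) (Dn : ℕ) :
    {N : ℕ | 4 * q ≤ N ∧ ∃ r W : ℚ, W ≠ 0 ∧ W = r * 2 ^ (s * (N ! / q)) ∧
      bev (xPolyP k c) (partialSum 2 N) r = 0 ∧ W.den ≤ Dn ∧ |(W : ℝ)| ≤ C * 2 ^ (s * (N ! / q)) ∧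
      ‖(W : PadicAlgCl 2) - β‖ ^ μ ≤
        A * ((1 / 2 : ℝ) ^ (G * (N ! / q)) + (1 / 2 : ℝ) ^ (Nat.factorial N - Nat.factorial (N - 1)))}.Finite := by
  classical
  have hαalg : IsAlgebraic ℚ (((Dn ! : ℕ) : PadicAlgCl 2) * β) := by
    have := hβalg.nsmul (Dn !)
    rwa [nsmul_eq_mul] at this
  have ht : 0 < 2 * μ * s := by positivity
  have hε : (0 : ℝ) < 1 / ((2 * μ * s : ℕ) : ℝ) := by positivity
  have hΞ := ridout_two _ hαalg hε
  set C₁ : ℝ := max C 1 * ((Dn ! : ℕ) : ℝ) with hC₁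
  have hC₁0 : 0 < C₁ := by positivity
  set A₁ : ℝ := A ^ (2 * s) * C₁ ^ (2 * μ * s + 1) * 4 ^ s with hA₁
  obtain ⟨N₃, hN₃⟩ := eventually_small A₁ 1 one_pos
  set Am : ℤ → Set ℕ := fun m => {N : ℕ | m ≠ 0 ∧ q ≤ N ∧
    bev (xPolyP k c) (partialSum 2 N) ((((m : ℚ) / (Dn ! : ℕ) : ℚ) : ℝ) / 2 ^ (s * (N ! / q))) = 0}
    with hAm
  have hAmfin : ∀ m : ℤ, (Am m).Finite := by
    intro m
    by_cases hm : m = 0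
    · refine (Set.finite_empty).subset ?_
      rintro N ⟨hm0, -, -⟩
      exact (hm0 hm).elim
    · have hW₀ : ((m : ℚ) / (Dn ! : ℕ) : ℚ) ≠ 0 :=
        div_ne_zero (Int.cast_ne_zero.mpr hm) (by positivity)
      exact (arch_finite (xPolyP k c) (xPolyP_ne_zero hB) hW₀ hs hq).subset fun N hN => hN.2
  refine ((Set.finite_lt_nat N₃).union (Set.Finite.biUnion hΞ fun m _ => hAmfin m)).subset ?_
  rintro N ⟨hN4, r, W, hW0, hrW, hP, hden, habs, hβW⟩
  by_cases hlt : N < N₃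
  · exact Or.inl hlt
  right
  push Not at hlt
  have hqN : q ≤ N := le_trans (Nat.le_mul_of_pos_left q (by norm_num)) hN4
  have hn : N ! = q * (N ! / q) := (Nat.mul_div_cancel' (Nat.dvd_factorial hq hqN)).symm
  -- the integer `m = W · Dn!`
  obtain ⟨e, he⟩ : W.den ∣ Dn ! := Nat.dvd_factorial W.den_pos hden
  set m : ℤ := W.num * e with hmdef
  have hmW : (m : ℚ) = W * ((Dn ! : ℕ) : ℚ) := by
    rw [hmdef, he]; push_cast
    rw [← mul_assoc, Rat.mul_den_eq_num]
  have he0 : e ≠ 0 := by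
    intro h0; rw [h0, mul_zero] at he; exact (Nat.factorial_ne_zero Dn) he
  have hm0 : m ≠ 0 := mul_ne_zero (Rat.num_ne_zero.mpr hW0) (by exact_mod_cast he0)
  have hmC : (m : PadicAlgCl 2) = (W : PadicAlgCl 2) * ((Dn ! : ℕ) : PadicAlgCl 2) := by
    have : ((m : ℚ) : PadicAlgCl 2) = ((W * ((Dn ! : ℕ) : ℚ) : ℚ) : PadicAlgCl 2) := by rw [hmW]
    push_cast at this
    exact this
  have hmR : (m : ℝ) = (W : ℝ) * ((Dn ! : ℕ) : ℝ) := by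
    have : ((m : ℚ) : ℝ) = ((W * ((Dn ! : ℕ) : ℚ) : ℚ) : ℝ) := by rw [hmW]
    push_cast at this
    exact this
  have hmabs : |(m : ℝ)| ≤ C₁ * 2 ^ (s * (N ! / q)) := by
    rw [hmR, abs_mul, Nat.abs_cast, hC₁]
    have h2 : C * 2 ^ (s * (N ! / q)) ≤ max C 1 * 2 ^ (s * (N ! / q)) :=
      mul_le_mul_of_nonneg_right (le_max_left _ _) (by positivity)
    calc |(W : ℝ)| * ((Dn ! : ℕ) : ℝ) ≤ (max C 1 * 2 ^ (s * (N ! / q))) * ((Dn ! : ℕ) : ℝ) :=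
          mul_le_mul_of_nonneg_right (habs.trans h2) (by positivity)
      _ = max C 1 * ((Dn ! : ℕ) : ℝ) * 2 ^ (s * (N ! / q)) := by ring
  have hmpos : 0 < |(m : ℝ)| := abs_pos.mpr (by exact_mod_cast hm0)
  -- membership in the Ridout exceptional set
  have hmem_Ξ : m ∈ {m : ℤ | min (1 : ℝ) ‖(m : PadicAlgCl 2) - ((Dn ! : ℕ) : PadicAlgCl 2) * β‖ <
      |(m : ℝ)| ^ (-(1 + 1 / ((2 * μ * s : ℕ) : ℝ)))} := by
    rw [Set.mem_setOf_eq]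
    have hle : min (1 : ℝ) ‖(m : PadicAlgCl 2) - ((Dn ! : ℕ) : PadicAlgCl 2) * β‖ ≤
        ‖(W : PadicAlgCl 2) - β‖ := by
      rw [hmC, show (W : PadicAlgCl 2) * ((Dn ! : ℕ) : PadicAlgCl 2) - ((Dn ! : ℕ) : PadicAlgCl 2) * β =
        ((Dn ! : ℕ) : PadicAlgCl 2) * ((W : PadicAlgCl 2) - β) by ring, norm_mul]
      calc min (1 : ℝ) (‖((Dn ! : ℕ) : PadicAlgCl 2)‖ * ‖(W : PadicAlgCl 2) - β‖)
          ≤ ‖((Dn ! : ℕ) : PadicAlgCl 2)‖ * ‖(W : PadicAlgCl 2) - β‖ := min_le_right _ _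
        _ ≤ 1 * ‖(W : PadicAlgCl 2) - β‖ :=
            mul_le_mul_of_nonneg_right (norm_natCast_le_one_st _) (norm_nonneg _)
        _ = ‖(W : PadicAlgCl 2) - β‖ := one_mul _
    refine lt_of_le_of_lt hle (lt_rpow_neg_of_pow_mul_pow_lt hmpos ht ?_)
    -- `‖W − β‖^{2μs} · |m|^{2μs+1} < 1`
    have hx : ‖(W : PadicAlgCl 2) - β‖ ^ (2 * μ * s) ≤
        (A * ((1 / 2 : ℝ) ^ (G * (N ! / q)) + (1 / 2 : ℝ) ^ (Nat.factorial N - Nat.factorial (N - 1)))) ^ (2 * s) := by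
      rw [show 2 * μ * s = μ * (2 * s) by ring, pow_mul]
      exact pow_le_pow_left₀ (by positivity) hβW _
    have hy : |(m : ℝ)| ^ (2 * μ * s + 1) ≤ (C₁ * 2 ^ (s * (N ! / q))) ^ (2 * μ * s + 1) :=
      pow_le_pow_left₀ (abs_nonneg _) hmabs _
    have hdec := decay_bound hs hq hN4 hn hG hQ
    calc ‖(W : PadicAlgCl 2) - β‖ ^ (2 * μ * s) * |(m : ℝ)| ^ (2 * μ * s + 1)
        ≤ (A * ((1 / 2 : ℝ) ^ (G * (N ! / q)) + (1 / 2 : ℝ) ^ (Nat.factorial N - Nat.factorial (N - 1)))) ^ (2 * s) *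
          (C₁ * 2 ^ (s * (N ! / q))) ^ (2 * μ * s + 1) :=
          mul_le_mul hx hy (by positivity) (by positivity)
      _ = A ^ (2 * s) * C₁ ^ (2 * μ * s + 1) *
          (((1 / 2 : ℝ) ^ (G * (N ! / q)) + (1 / 2 : ℝ) ^ (Nat.factorial N - Nat.factorial (N - 1))) ^ (2 * s) *
            (2 : ℝ) ^ (s * (N ! / q) * (2 * μ * s + 1))) := by
          rw [mul_pow, mul_pow, ← pow_mul]; ring
      _ ≤ A ^ (2 * s) * C₁ ^ (2 * μ * s + 1) * ((4 : ℝ) ^ s * (1 / 2 : ℝ) ^ (N - 1)!) :=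
          mul_le_mul_of_nonneg_left hdec (by positivity)
      _ = A₁ * (1 / 2 : ℝ) ^ (N - 1)! := by rw [hA₁]; ring
      _ < 1 := hN₃ N hlt
  refine Set.mem_biUnion hmem_Ξ ⟨hm0, hqN, ?_⟩
  have hDn0 : ((Dn ! : ℕ) : ℚ) ≠ 0 := by positivity
  have hWm : ((m : ℚ) / (Dn ! : ℕ) : ℚ) = W := by rw [hmW, mul_div_cancel_right₀ W hDn0]
  have hr : ((((m : ℚ) / (Dn ! : ℕ) : ℚ) : ℝ) / 2 ^ (s * (N ! / q))) = (r : ℝ) := by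
    rw [hWm, hrW]; push_cast
    rw [mul_div_cancel_right₀ _ (by positivity)]
  rw [hr]
  exact hP

/-- `n = N!/q ≥ (N−1)!` once `4q ≤ N`. -/
theorem factorial_pred_le_div {N q : ℕ} (hq : 0 < q) (hN : 4 * q ≤ N) : (N - 1)! ≤ N ! / q := by
  have hqN : q ≤ N := le_trans (Nat.le_mul_of_pos_left q (by norm_num)) hN
  have hn : N ! = q * (N ! / q) := (Nat.mul_div_cancel' (Nat.dvd_factorial hq hqN)).symm
  have := four_mul_factorial_le hq hN hn
  omega

end Summit.Schanuel.Schanuel.Theorems.RootDecomp1KSectorTheorem
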